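import Summits.ValiantsHypothesis.ValiantsHypothesis.Theorems.LacunarySymmetroidMatrixDescartesDoorA26WallBubblingConfluentLimit
import Summits.ValiantsHypothesis.ValiantsHypothesis.Theorems.LacunarySymmetroidMatrixDescartesDoorA26WallBubblingBubblingAssembly

/-!
# Wall bubbling for `DoorA26` — (W-split) rung 1: TROPICAL MONOTONICITY OF CONFLUENT LIMITS ACROSS TWO SCALES (B8 at the finer level)

HONEST FRAMING.  Chain lemma for obligation (W) `stub_weylFaces` of `Cruxes/DoorA26/Lines/wall_bubbling.lean` (stmt-ValiantsHypothesis-19979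
`DoorA26`; OPEN, typed, never asserted), W2 seat val-sym-door-p1 g14; the named residual «(W-split) multi-scale linking» of the line lead's
`Cruxes/DoorA26/Lines/wall_bubbling_ConfluentDoor.lean` rev 4 (register R2761).  This is the FIRST RUNG of (W-split) in the kernel: the hypothesis `hmono`
of the count `…WallBubblingChainCeiling.chain_ceiling` (p663233) for confluent limits.

SETTING.  ONE sequence of letters `U^ν : Fin 6 → Sym₂(ℝ)` (already recentred at a first cluster), exponents `δ^ν → δ0` on a Weyl face
(`δ0 5 = δ0 0`), and a second cluster at log-distance `L_ν → +∞`: the letters seen there are `e^{δ^ν_l L_ν}U^ν_l`.  The CONFLUENT FRAMES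
(`…ConfluentLimit.frame_det`: positions `0 ↦ U₀ + U₅`, `5 ↦ (δ₅ − δ₀)·U₅`, `k ↦ U_k`) at the two clusters are linked by the TRANSVECTED RESCALING
(`frame_shift`): `V'_l = e^{δ_l L}·(V_l + [l = 0]·Λ'·V₅)`, `Λ' = dslope (y ↦ e^{yL}) 0 (δ₅ − δ₀)` (`= (e^{wL} − 1)/w`, `= L` at `w = 0`), `|Λ'| ≤ L e^{|w|L}`
(`abs_dslope_exp_le`).  The transvection mixes polar Gram entries only WITHIN limit value classes (positions `0` and `5` carry the same limit exponent),
hence the two-sided transfer bounds `polar_shift_le` / `polar_unshift_le`, and: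

* **`twoScale_monotone`** — if the Gram-normalised frames converge at both clusters (`G/μ → Γ`, `G'/μ' → Γ'`, entries dominated by `μ, μ'`), then every
  entry alive in `Γ` has limit value `≤` that of every entry alive in `Γ'`: `Γ p q ≠ 0 → Γ' p' q' ≠ 0 → δ0 p + δ0 q ≤ δ0 p' + δ0 q'`.
  Mechanism (B8 one level down): `κκ' ≤ (1 + |Λ'|)⁴ e^{(v' − v + 2|w|)L}` with stage values `v, v'`, and `(1 + L e^{dL/16})⁴e^{−dL/2} → 0`.

So the active value sets of the confluent limits of consecutive clusters are ordered with at most a shared endpoint — the `hmono` input of the chain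
ceiling; together with the per-cluster extended count (W1 #12 + W2 #5) this leaves SLOT SPLITTING (`hsplit`) as the one un-typed input of the count, and
the count itself caps at 20 (`chain_ceiling_attained_two_clusters`): (W-split) proper is a statement about pencils.  No new definitions; nothing here
bears on `DoorA26`, `MatrixDescartes` (stmt-ValiantsHypothesis-18050) or `VP ≠ VNP`.

[folklore] tropical (valuation) monotonicity; [this work] the confluent two-scale transfer.
-/

-- `Summit.ValiantsHypothesis.ValiantsHypothesis.…` repeats a component by the D-0017 layout
-- (single-conjunct summit), which the `dupNamespace` linter flags; the name is mandated.
set_option linter.dupNamespace false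

namespace Summit.ValiantsHypothesis.ValiantsHypothesis.Theorems.LacunarySymmetroidMatrixDescartes.WallBubbling

open Finset Filter Topology
open Bubbling (polar polar_apply polar_comm polar_smul_left_right)
open scoped BigOperators

/-! ## 1. The transvected rescaling of the frame -/

/-- `polar` against an affine combination in the first slot. [folklore] -/
theorem polar_add_smul_left (S T X : Matrix (Fin 2) (Fin 2) ℝ) (c : ℝ) :
    polar (S + c • T) X = polar S X + c * polar T X := by
  rw [polar_apply, polar_apply, polar_apply]
  simp only [Matrix.add_apply, Matrix.smul_apply, smul_eq_mul]
  ring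

/-- `polar` of two transvected-rescaled vectors. [folklore] -/
theorem polar_shift_expand (X Y Z : Matrix (Fin 2) (Fin 2) ℝ) (a b c d : ℝ) :
    polar (a • (X + c • Z)) (b • (Y + d • Z)) = a * b * (polar X Y + d * polar X Z + c * polar Z Y + c * d * polar Z Z) := by
  rw [polar_smul_left_right, polar_add_smul_left, polar_comm X (Y + d • Z), polar_add_smul_left, polar_comm Z (Y + d • Z),
    polar_add_smul_left, polar_comm Y X, polar_comm Z X, polar_comm Y Z]
  ring

/-- `|dslope (y ↦ e^{yL}) 0 w| ≤ |L|·e^{|w||L|}` (the transvection coefficient is sub-exponential in `L` when `w → 0`). [folklore] -/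
theorem abs_dslope_exp_le (L w : ℝ) :
    |dslope (fun y : ℝ => Real.exp (y * L)) 0 w| ≤ |L| * Real.exp (|w| * |L|) := by
  obtain ⟨ξ, hξ, heq⟩ := exists_dslope_pow_mul_exp_eq 0 L 0 w
  have h0 : (fun y : ℝ => Real.exp (y * L)) = fun y => y ^ 0 * Real.exp (y * L) := by funext y; simp
  rw [h0, heq]
  simp only [Nat.cast_zero, zero_mul, pow_zero, mul_one, zero_add]
  rw [abs_mul, abs_of_pos (Real.exp_pos _)]
  refine mul_le_mul_of_nonneg_left (Real.exp_le_exp.mpr ?_) (abs_nonneg L)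
  have hξ' : |ξ| ≤ |w| := by
    rcases Set.mem_uIcc.mp hξ with ⟨h1, h2⟩ | ⟨h1, h2⟩
    · rw [abs_of_nonneg h1]; exact le_trans h2 (le_abs_self w)
    · rw [abs_of_nonpos h2]; exact le_trans (neg_le_neg h1) (neg_le_abs w)
  calc ξ * L ≤ |ξ * L| := le_abs_self _
    _ = |ξ| * |L| := abs_mul ξ L
    _ ≤ |w| * |L| := mul_le_mul_of_nonneg_right hξ' (abs_nonneg L)

/-- **THE TWO-SCALE TRANSFER OF THE CONFLUENT FRAME.**  With `U'_l = e^{δ_l L}U_l`: `V'_l = e^{δ_l L}·(V_l + [l = 0]·Λ'·V₅)`,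
`Λ' = dslope (y ↦ e^{yL}) 0 (δ₅ − δ₀)`. [this work] -/
theorem frame_shift (δ : Fin 6 → ℝ) (U : Fin 6 → Matrix (Fin 2) (Fin 2) ℝ) (L : ℝ) (l : Fin 6) :
    (if l = 0 then Real.exp (δ 0 * L) • U 0 + Real.exp (δ 5 * L) • U 5
      else if l = 5 then (δ 5 - δ 0) • (Real.exp (δ 5 * L) • U 5) else Real.exp (δ l * L) • U l)
      = Real.exp (δ l * L) • ((if l = 0 then U 0 + U 5 else if l = 5 then (δ 5 - δ 0) • U 5 else U l)
          + (if l = 0 then dslope (fun y : ℝ => Real.exp (y * L)) 0 (δ 5 - δ 0) else 0) • ((δ 5 - δ 0) • U 5)) := by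
  by_cases h0 : l = 0
  · subst h0
    have h05 : ((0 : Fin 6) = 5) = False := by simp
    simp only [if_true, h05, if_false]
    have key : Real.exp (δ 5 * L) = Real.exp (δ 0 * L) * (1 + dslope (fun y : ℝ => Real.exp (y * L)) 0 (δ 5 - δ 0) * (δ 5 - δ 0)) := by
      have h := sub_mul_dslope_exp 0 (δ 5 - δ 0) L
      rw [zero_mul, Real.exp_zero, sub_zero] at h
      rw [mul_comm (dslope _ _ _), h, add_sub_cancel, ← Real.exp_add]
      congr 1; ring
    rw [key]
    simp only [smul_add, smul_smul]
    module
  · by_cases h5 : l = 5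
    · subst h5
      simp only [h0, if_false, if_true, zero_smul, add_zero]
      rw [smul_comm]
    · simp only [h0, h5, if_false, zero_smul, add_zero]

/-! ## 2. Transfer bounds for the polar Gram entries -/

/-- Forward bound: `|G'_{pq}| ≤ e^{(δ_p+δ_q)L}(1 + |Λ'|)²·μ` when all `|G_{ab}| ≤ μ`. [this work] -/
theorem polar_shift_le (V : Fin 6 → Matrix (Fin 2) (Fin 2) ℝ) (δ : Fin 6 → ℝ) (L Λ μ : ℝ) (hμ : ∀ a b, |polar (V a) (V b)| ≤ μ)
    (p q : Fin 6) :
    |polar (Real.exp (δ p * L) • (V p + (if p = 0 then Λ else 0) • V 5)) (Real.exp (δ q * L) • (V q + (if q = 0 then Λ else 0) • V 5))|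
      ≤ Real.exp ((δ p + δ q) * L) * (1 + |Λ|) ^ 2 * μ := by
  have hμ0 : 0 ≤ μ := le_trans (abs_nonneg _) (hμ 0 0)
  have hc : ∀ r : Fin 6, |(if r = 0 then Λ else 0)| ≤ |Λ| := by
    intro r; split_ifs
    · exact le_refl _
    · rw [abs_zero]; exact abs_nonneg _
  set c := (if p = 0 then Λ else 0) with hcdef
  set d := (if q = 0 then Λ else 0) with hddef
  have hcΛ : |c| ≤ |Λ| := hc p
  have hdΛ : |d| ≤ |Λ| := hc q
  have hX : |polar (V p) (V q) + d * polar (V p) (V 5) + c * polar (V 5) (V q) + c * d * polar (V 5) (V 5)| ≤ (1 + |Λ|) ^ 2 * μ := by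
    calc |polar (V p) (V q) + d * polar (V p) (V 5) + c * polar (V 5) (V q) + c * d * polar (V 5) (V 5)|
        ≤ |polar (V p) (V q)| + |d * polar (V p) (V 5)| + |c * polar (V 5) (V q)| + |c * d * polar (V 5) (V 5)| := by
          have t1 := abs_add_le (polar (V p) (V q) + d * polar (V p) (V 5) + c * polar (V 5) (V q)) (c * d * polar (V 5) (V 5))
          have t2 := abs_add_le (polar (V p) (V q) + d * polar (V p) (V 5)) (c * polar (V 5) (V q))
          have t3 := abs_add_le (polar (V p) (V q)) (d * polar (V p) (V 5))
          linarith
      _ ≤ μ + |Λ| * μ + |Λ| * μ + |Λ| * |Λ| * μ := by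
          rw [abs_mul, abs_mul, abs_mul, abs_mul]
          refine add_le_add (add_le_add (add_le_add (hμ p q) ?_) ?_) ?_
          · exact mul_le_mul hdΛ (hμ p 5) (abs_nonneg _) (abs_nonneg _)
          · exact mul_le_mul hcΛ (hμ 5 q) (abs_nonneg _) (abs_nonneg _)
          · exact mul_le_mul (mul_le_mul hcΛ hdΛ (abs_nonneg _) (abs_nonneg _)) (hμ 5 5) (abs_nonneg _)
              (mul_nonneg (abs_nonneg _) (abs_nonneg _))
      _ = (1 + |Λ|) ^ 2 * μ := by ring
  rw [polar_shift_expand, abs_mul, abs_mul, abs_of_pos (Real.exp_pos _), abs_of_pos (Real.exp_pos _), add_mul, Real.exp_add]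
  calc Real.exp (δ p * L) * Real.exp (δ q * L) * |polar (V p) (V q) + d * polar (V p) (V 5) + c * polar (V 5) (V q) + c * d * polar (V 5) (V 5)|
      ≤ Real.exp (δ p * L) * Real.exp (δ q * L) * ((1 + |Λ|) ^ 2 * μ) :=
        mul_le_mul_of_nonneg_left hX (mul_pos (Real.exp_pos _) (Real.exp_pos _)).le
    _ = _ := by ring

/-- The forward bound AT THE FRAME LEVEL: the polar Gram entries of the frame of the shifted letters `e^{δ_l L}U_l` against those of the frame of
`U`. [this work] -/
theorem polar_frameShift_le (δ : Fin 6 → ℝ) (U : Fin 6 → Matrix (Fin 2) (Fin 2) ℝ) (L μ : ℝ)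
    (hμ : ∀ a b, |polar (if a = 0 then U 0 + U 5 else if a = 5 then (δ 5 - δ 0) • U 5 else U a)
      (if b = 0 then U 0 + U 5 else if b = 5 then (δ 5 - δ 0) • U 5 else U b)| ≤ μ) (p q : Fin 6) :
    |polar (if p = 0 then Real.exp (δ 0 * L) • U 0 + Real.exp (δ 5 * L) • U 5
        else if p = 5 then (δ 5 - δ 0) • (Real.exp (δ 5 * L) • U 5) else Real.exp (δ p * L) • U p)
      (if q = 0 then Real.exp (δ 0 * L) • U 0 + Real.exp (δ 5 * L) • U 5
        else if q = 5 then (δ 5 - δ 0) • (Real.exp (δ 5 * L) • U 5) else Real.exp (δ q * L) • U q)|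
      ≤ Real.exp ((δ p + δ q) * L) * (1 + |dslope (fun y : ℝ => Real.exp (y * L)) 0 (δ 5 - δ 0)|) ^ 2 * μ := by
  have h50 : ((5 : Fin 6) = 0) = False := by simp
  have key := polar_shift_le (fun a => if a = 0 then U 0 + U 5 else if a = 5 then (δ 5 - δ 0) • U 5 else U a) δ L
    (dslope (fun y : ℝ => Real.exp (y * L)) 0 (δ 5 - δ 0)) μ hμ p q
  simp only [h50, if_false, if_true] at key
  rw [frame_shift δ U L p, frame_shift δ U L q]
  exact key

/-- Shifting back: `e^{δ_l(−L)}·(e^{δ_l L}U_l) = U_l`. [folklore] -/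
theorem shift_neg_shift (δ : Fin 6 → ℝ) (U : Fin 6 → Matrix (Fin 2) (Fin 2) ℝ) (L : ℝ) (l : Fin 6) :
    Real.exp (δ l * (-L)) • (Real.exp (δ l * L) • U l) = U l := by
  rw [smul_smul, ← Real.exp_add, show δ l * (-L) + δ l * L = 0 by ring, Real.exp_zero, one_smul]

/-- Scalar bookkeeping of the two transfer bounds: `κμ ≤ e₁a₂μ'`, `κ'μ' ≤ e₂a₁μ`, `e₁e₂ ≤ E`, `a₂a₁ ≤ A` ⇒ `κκ' ≤ A·E`. [folklore] -/
theorem scale_combine {κ κ' μ μ' e₁ e₂ a₁ a₂ A E : ℝ} (hμ : 0 < μ) (hμ' : 0 < μ') (hκ' : 0 ≤ κ')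
    (he₁ : 0 ≤ e₁) (he₂ : 0 ≤ e₂) (ha₁ : 0 ≤ a₁) (ha₂ : 0 ≤ a₂) (hE : 0 ≤ E)
    (hA : κ * μ ≤ e₁ * a₂ * μ') (hB : κ' * μ' ≤ e₂ * a₁ * μ) (he : e₁ * e₂ ≤ E) (ha : a₂ * a₁ ≤ A) :
    κ * κ' ≤ A * E := by
  have h1 : (κ * μ) * (κ' * μ') ≤ (e₁ * a₂ * μ') * (e₂ * a₁ * μ) :=
    mul_le_mul hA hB (mul_nonneg hκ' hμ'.le) (mul_nonneg (mul_nonneg he₁ ha₂) hμ'.le)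
  have h1' : 0 ≤ e₂ * a₁ := mul_nonneg he₂ ha₁
  have h2 : (e₁ * a₂ * μ') * (e₂ * a₁ * μ) = ((e₁ * e₂) * (a₂ * a₁)) * (μ * μ') := by ring
  have h3 : (e₁ * e₂) * (a₂ * a₁) ≤ E * A :=
    mul_le_mul he ha (mul_nonneg ha₂ ha₁) hE
  have hμμ : 0 < μ * μ' := mul_pos hμ hμ'
  have h4 : (κ * κ') * (μ * μ') ≤ (A * E) * (μ * μ') := by
    calc (κ * κ') * (μ * μ') = (κ * μ) * (κ' * μ') := by ring
      _ ≤ (e₁ * a₂ * μ') * (e₂ * a₁ * μ) := h1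
      _ = ((e₁ * e₂) * (a₂ * a₁)) * (μ * μ') := h2
      _ ≤ (E * A) * (μ * μ') := mul_le_mul_of_nonneg_right h3 hμμ.le
      _ = (A * E) * (μ * μ') := by ring
  exact le_of_mul_le_mul_right h4 hμμ

/-! ## 3. Tropical monotonicity across two scales -/

/-- `(1 + L e^{aL})⁴ e^{−bL} → 0` along `L → +∞` when `8a < b`… packaged as: for `0 < d`, eventually
`(1 + L e^{dL/16})⁴ e^{−dL/2} < η`. [folklore] -/
theorem transvection_decay (d η : ℝ) (hd : 0 < d) (hη : 0 < η) (L : ℕ → ℝ) (hL : Tendsto L atTop atTop) :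
    ∀ᶠ ν in atTop, (1 + L ν * Real.exp (d / 16 * L ν)) ^ 4 * Real.exp (-(d / 2 * L ν)) < η := by
  -- `x ↦ x⁴ e^{−x}` at `x = dL/4`: `(1 + L e^{dL/16})⁴ e^{−dL/2} ≤ (2L e^{dL/16})⁴ e^{−dL/2} = 16 L⁴ e^{−dL/4}` for `L e^{dL/16} ≥ 1`
  have hlim : Tendsto (fun ν => (d / 4 * L ν) ^ 4 * Real.exp (-(d / 4 * L ν))) atTop (𝓝 0) :=
    (Real.tendsto_pow_mul_exp_neg_atTop_nhds_zero 4).comp (Filter.Tendsto.const_mul_atTop (by positivity) hL)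
  have hlim' : Tendsto (fun ν => (16 * (4 / d) ^ 4) * ((d / 4 * L ν) ^ 4 * Real.exp (-(d / 4 * L ν)))) atTop (𝓝 0) := by
    have := hlim.const_mul (16 * (4 / d) ^ 4)
    rw [mul_zero] at this
    exact this
  have hev := (hlim'.eventually (gt_mem_nhds hη))
  have hL1 : ∀ᶠ ν in atTop, 1 ≤ L ν := hL.eventually_ge_atTop 1
  filter_upwards [hev, hL1] with ν hν hν1
  have hLpos : 0 < L ν := lt_of_lt_of_le zero_lt_one hν1
  have hexp1 : 1 ≤ Real.exp (d / 16 * L ν) := Real.one_le_exp (by positivity)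
  have hbase : 1 ≤ L ν * Real.exp (d / 16 * L ν) := by nlinarith
  have hpow : (1 + L ν * Real.exp (d / 16 * L ν)) ^ 4 ≤ (2 * (L ν * Real.exp (d / 16 * L ν))) ^ 4 := by
    apply pow_le_pow_left₀ (by positivity)
    linarith
  have hid : (2 * (L ν * Real.exp (d / 16 * L ν))) ^ 4 * Real.exp (-(d / 2 * L ν))
      = (16 * (4 / d) ^ 4) * ((d / 4 * L ν) ^ 4 * Real.exp (-(d / 4 * L ν))) := by
    have hd0 : d ≠ 0 := hd.ne'
    rw [mul_pow, mul_pow, ← Real.exp_nat_mul]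
    have : Real.exp (↑(4 : ℕ) * (d / 16 * L ν)) * Real.exp (-(d / 2 * L ν)) = Real.exp (-(d / 4 * L ν)) := by
      rw [← Real.exp_add]; congr 1; push_cast; ring
    calc (2 : ℝ) ^ 4 * (L ν ^ 4 * Real.exp (↑(4 : ℕ) * (d / 16 * L ν))) * Real.exp (-(d / 2 * L ν))
        = 2 ^ 4 * L ν ^ 4 * (Real.exp (↑(4 : ℕ) * (d / 16 * L ν)) * Real.exp (-(d / 2 * L ν))) := by ring
      _ = 2 ^ 4 * L ν ^ 4 * Real.exp (-(d / 4 * L ν)) := by rw [this]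
      _ = (16 * (4 / d) ^ 4) * ((d / 4 * L ν) ^ 4 * Real.exp (-(d / 4 * L ν))) := by field_simp; ring
  calc (1 + L ν * Real.exp (d / 16 * L ν)) ^ 4 * Real.exp (-(d / 2 * L ν))
      ≤ (2 * (L ν * Real.exp (d / 16 * L ν))) ^ 4 * Real.exp (-(d / 2 * L ν)) :=
        mul_le_mul_of_nonneg_right hpow (Real.exp_pos _).le
    _ = (16 * (4 / d) ^ 4) * ((d / 4 * L ν) ^ 4 * Real.exp (-(d / 4 * L ν))) := hid
    _ < η := hν

/-- **TROPICAL MONOTONICITY OF CONFLUENT LIMITS ACROSS TWO SCALES** (B8 at the finer level; the `hmono` input of `chain_ceiling`).  Letters `U^ν`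
(recentred at the first cluster), exponents `δ^ν → δ0` with `δ0 5 = δ0 0`, shifts `L_ν → +∞`; the confluent frames of `U^ν` and of the shifted letters
`e^{δ_l L}U^ν_l` (both written inline).  If the Gram-normalised frames converge at both scales with dominated entries, an entry alive in the first limit
has limit value at most that of any entry alive in the second. [this work] -/
theorem twoScale_monotone (δs : ℕ → Fin 6 → ℝ) (δ0 : Fin 6 → ℝ)
    (hδ : ∀ l, Tendsto (fun ν => δs ν l) atTop (𝓝 (δ0 l))) (h05 : δ0 5 = δ0 0)
    (U : ℕ → Fin 6 → Matrix (Fin 2) (Fin 2) ℝ) (L : ℕ → ℝ) (hL : Tendsto L atTop atTop)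
    (μ μ' : ℕ → ℝ) (hμ : ∀ ν, 0 < μ ν) (hμ' : ∀ ν, 0 < μ' ν)
    (hdom : ∀ ν a b, |polar (if a = 0 then U ν 0 + U ν 5 else if a = 5 then (δs ν 5 - δs ν 0) • U ν 5 else U ν a)
      (if b = 0 then U ν 0 + U ν 5 else if b = 5 then (δs ν 5 - δs ν 0) • U ν 5 else U ν b)| ≤ μ ν)
    (hdom' : ∀ ν a b, |polar
      (if a = 0 then Real.exp (δs ν 0 * L ν) • U ν 0 + Real.exp (δs ν 5 * L ν) • U ν 5
        else if a = 5 then (δs ν 5 - δs ν 0) • (Real.exp (δs ν 5 * L ν) • U ν 5) else Real.exp (δs ν a * L ν) • U ν a)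
      (if b = 0 then Real.exp (δs ν 0 * L ν) • U ν 0 + Real.exp (δs ν 5 * L ν) • U ν 5
        else if b = 5 then (δs ν 5 - δs ν 0) • (Real.exp (δs ν 5 * L ν) • U ν 5) else Real.exp (δs ν b * L ν) • U ν b)| ≤ μ' ν)
    (Γ Γ' : Fin 6 → Fin 6 → ℝ)
    (hΓ : ∀ a b, Tendsto (fun ν => polar (if a = 0 then U ν 0 + U ν 5 else if a = 5 then (δs ν 5 - δs ν 0) • U ν 5 else U ν a)
      (if b = 0 then U ν 0 + U ν 5 else if b = 5 then (δs ν 5 - δs ν 0) • U ν 5 else U ν b) / μ ν) atTop (𝓝 (Γ a b)))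
    (hΓ' : ∀ a b, Tendsto (fun ν => polar
      (if a = 0 then Real.exp (δs ν 0 * L ν) • U ν 0 + Real.exp (δs ν 5 * L ν) • U ν 5
        else if a = 5 then (δs ν 5 - δs ν 0) • (Real.exp (δs ν 5 * L ν) • U ν 5) else Real.exp (δs ν a * L ν) • U ν a)
      (if b = 0 then Real.exp (δs ν 0 * L ν) • U ν 0 + Real.exp (δs ν 5 * L ν) • U ν 5
        else if b = 5 then (δs ν 5 - δs ν 0) • (Real.exp (δs ν 5 * L ν) • U ν 5) else Real.exp (δs ν b * L ν) • U ν b) / μ' ν)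
      atTop (𝓝 (Γ' a b)))
    (p q p' q' : Fin 6) (hpq : Γ p q ≠ 0) (hp'q' : Γ' p' q' ≠ 0) :
    δ0 p + δ0 q ≤ δ0 p' + δ0 q' := by
  by_contra hlt
  push Not at hlt
  set dd : ℝ := (δ0 p + δ0 q) - (δ0 p' + δ0 q') with hdd
  have hdpos : 0 < dd := by rw [hdd]; linarith
  set w : ℕ → ℝ := fun ν => δs ν 5 - δs ν 0 with hw
  set κ : ℝ := |Γ p q| / 2 with hκ
  set κ' : ℝ := |Γ' p' q'| / 2 with hκ'
  have hκpos : 0 < κ := by rw [hκ]; exact half_pos (abs_pos.mpr hpq)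
  have hκ'pos : 0 < κ' := by rw [hκ']; exact half_pos (abs_pos.mpr hp'q')
  -- eventual lower bounds on the alive entries
  have e1 : ∀ᶠ ν in atTop, κ * μ ν ≤ |polar (if p = 0 then U ν 0 + U ν 5 else if p = 5 then (δs ν 5 - δs ν 0) • U ν 5 else U ν p)
      (if q = 0 then U ν 0 + U ν 5 else if q = 5 then (δs ν 5 - δs ν 0) • U ν 5 else U ν q)| := by
    have h := ((hΓ p q).abs).eventually_const_lt (show κ < |Γ p q| by rw [hκ]; linarith [abs_pos.mpr hpq])
    filter_upwards [h] with ν hν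
    rw [abs_div, abs_of_pos (hμ ν), lt_div_iff₀ (hμ ν)] at hν
    exact hν.le
  have e2 : ∀ᶠ ν in atTop, κ' * μ' ν ≤ |polar
      (if p' = 0 then Real.exp (δs ν 0 * L ν) • U ν 0 + Real.exp (δs ν 5 * L ν) • U ν 5
        else if p' = 5 then (δs ν 5 - δs ν 0) • (Real.exp (δs ν 5 * L ν) • U ν 5) else Real.exp (δs ν p' * L ν) • U ν p')
      (if q' = 0 then Real.exp (δs ν 0 * L ν) • U ν 0 + Real.exp (δs ν 5 * L ν) • U ν 5
        else if q' = 5 then (δs ν 5 - δs ν 0) • (Real.exp (δs ν 5 * L ν) • U ν 5) else Real.exp (δs ν q' * L ν) • U ν q')| := by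
    have h := ((hΓ' p' q').abs).eventually_const_lt (show κ' < |Γ' p' q'| by rw [hκ']; linarith [abs_pos.mpr hp'q'])
    filter_upwards [h] with ν hν
    rw [abs_div, abs_of_pos (hμ' ν), lt_div_iff₀ (hμ' ν)] at hν
    exact hν.le
  -- the stage exponent gap and the Weyl gap
  have e3 : ∀ᶠ ν in atTop, (δs ν p' + δs ν q') - (δs ν p + δs ν q) ≤ -(dd / 2) := by
    have hlim : Tendsto (fun ν => (δs ν p' + δs ν q') - (δs ν p + δs ν q)) atTop (𝓝 ((δ0 p' + δ0 q') - (δ0 p + δ0 q))) :=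
      ((hδ p').add (hδ q')).sub ((hδ p).add (hδ q))
    exact (hlim.eventually (Iic_mem_nhds (by rw [hdd]; linarith))).mono fun ν hν => hν
  have e4 : ∀ᶠ ν in atTop, |w ν| ≤ dd / 16 := by
    have hw0 : Tendsto (fun ν => |w ν|) atTop (𝓝 |(0 : ℝ)|) := by
      have := (hδ 5).sub (hδ 0)
      rw [h05, sub_self] at this
      exact this.abs
    rw [abs_zero] at hw0
    exact (hw0.eventually (Iic_mem_nhds (by positivity))).mono fun ν hν => hν
  have e5 : ∀ᶠ ν in atTop, 0 ≤ L ν := hL.eventually_ge_atTop 0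
  have e6 := transvection_decay dd (κ * κ') hdpos (mul_pos hκpos hκ'pos) L hL
  -- contradiction at a late stage
  have hfalse : ∀ᶠ ν : ℕ in atTop, False := by
    filter_upwards [e1, e2, e3, e4, e5, e6] with ν h1 h2 h3 h4 h5 h6
    -- forward transfer bound at the second scale
    have hfwd := polar_frameShift_le (δs ν) (U ν) (L ν) (μ ν) (hdom ν) p' q'
    -- backward transfer bound: shift the shifted letters by `−L`
    have hbwd := polar_frameShift_le (δs ν) (fun l => Real.exp (δs ν l * L ν) • U ν l) (-(L ν)) (μ' ν) (hdom' ν) p q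
    simp only [shift_neg_shift] at hbwd
    -- the two transvection coefficients are `≤ L e^{|w|L} ≤ L e^{dd L/16}`
    have hE : Real.exp (|w ν| * L ν) ≤ Real.exp (dd / 16 * L ν) := Real.exp_le_exp.mpr (mul_le_mul_of_nonneg_right h4 h5)
    have hΛ₁c : 1 + |dslope (fun y : ℝ => Real.exp (y * L ν)) 0 (δs ν 5 - δs ν 0)| ≤ 1 + L ν * Real.exp (dd / 16 * L ν) := by
      have hb := abs_dslope_exp_le (L ν) (δs ν 5 - δs ν 0)
      rw [abs_of_nonneg h5] at hb
      nlinarith [hb, hE, h5, Real.exp_pos (|w ν| * L ν)]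
    have hΛ₂c : 1 + |dslope (fun y : ℝ => Real.exp (y * -L ν)) 0 (δs ν 5 - δs ν 0)| ≤ 1 + L ν * Real.exp (dd / 16 * L ν) := by
      have hb := abs_dslope_exp_le (-(L ν)) (δs ν 5 - δs ν 0)
      rw [abs_neg, abs_of_nonneg h5] at hb
      nlinarith [hb, hE, h5, Real.exp_pos (|w ν| * L ν)]
    have hΛ4 : (1 + |dslope (fun y : ℝ => Real.exp (y * -L ν)) 0 (δs ν 5 - δs ν 0)|) ^ 2
        * (1 + |dslope (fun y : ℝ => Real.exp (y * L ν)) 0 (δs ν 5 - δs ν 0)|) ^ 2 ≤ (1 + L ν * Real.exp (dd / 16 * L ν)) ^ 4 := by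
      have h1' := pow_le_pow_left₀ (by positivity) hΛ₁c 2
      have h2' := pow_le_pow_left₀ (by positivity) hΛ₂c 2
      calc _ ≤ (1 + L ν * Real.exp (dd / 16 * L ν)) ^ 2 * (1 + L ν * Real.exp (dd / 16 * L ν)) ^ 2 :=
            mul_le_mul h2' h1' (by positivity) (by positivity)
        _ = (1 + L ν * Real.exp (dd / 16 * L ν)) ^ 4 := by ring
    have hexp : Real.exp ((δs ν p + δs ν q) * -L ν) * Real.exp ((δs ν p' + δs ν q') * L ν) ≤ Real.exp (-(dd / 2 * L ν)) := by
      rw [← Real.exp_add]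
      apply Real.exp_le_exp.mpr
      have hh := mul_le_mul_of_nonneg_right h3 h5
      have : (δs ν p + δs ν q) * -L ν + (δs ν p' + δs ν q') * L ν = ((δs ν p' + δs ν q') - (δs ν p + δs ν q)) * L ν := by ring
      rw [this]
      linarith
    -- combine
    have hfin : κ * κ' ≤ (1 + L ν * Real.exp (dd / 16 * L ν)) ^ 4 * Real.exp (-(dd / 2 * L ν)) :=
      scale_combine (hμ ν) (hμ' ν) hκ'pos.le (Real.exp_pos _).le (Real.exp_pos _).le (by positivity) (by positivity)
        (Real.exp_pos _).le (le_trans h1 hbwd) (le_trans h2 hfwd) hexp hΛ4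
    exact absurd (lt_of_le_of_lt hfin h6) (lt_irrefl _)
  exact hfalse.exists.elim fun _ h => h

end Summit.ValiantsHypothesis.ValiantsHypothesis.Theorems.LacunarySymmetroidMatrixDescartes.WallBubbling
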